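import Summits.CriticalPhenomena.PercolationContinuityZ3.Theorems.PercNearOneGluingNoHeavyLowerTailSahiCTCLadderSupplyGeneralPinned
import Summits.CriticalPhenomena.PercolationContinuityZ3.Theorems.PercNearOneGluingNoHeavyLowerTailSahiCTCKleitmanPinnedT
import HarnessLib

/-!
# `NoHeavyLowerTail` (crux stmt-CriticalPhenomena-4575), P3 lane: plain and pinned supply of one cube (general row)

Support file (seat `prim-l12-p3`, gen 26; `--supports stmt-CriticalPhenomena-4575`).  README blueprint step 2, general form, third part:
the `t`-DENSITY and the PINNED `t`-density inequalities of the cube `(A, Y)` (base `D ∖ A`, free `F = A ∪ (T ∖ Y)`, level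
`ℓ = t − #(D ∖ A)`) with the common sets replaced by the charged kinds they contain:
`cH(ℓ, #F) · Σ_j #kindsIn_j(A,Y) ≤ C(#F, ℓ) · κ(A,Y)` (`cube_plain_supply`) and, for `p ∈ A`, the pinned analogue
(`cube_pinned_supply`).  Summing these over the cubes of a type (with `sum_card_kindsIn`) gives the supply facts of any row.
Nothing is asserted about the crux.
-/

namespace Summit.CriticalPhenomena.PercolationContinuityZ3.Theorems.SahiCTCForms

open Finset MvPolynomial SahiCTCGenFun SahiCTCWeightedLYM

variable {α : Type*} [DecidableEq α] [Fintype α]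

section SupplyGeneralCube
variable {𝒳 𝒵 : Finset (Finset α)}

omit [Fintype α] in
/-- Traces of a `t`-live family on the cube `(A, Y)` have at least `t − #(D ∖ A)` points. [this work] -/
theorem le_card_of_mem_tr_cube {t : ℕ} (hXt : ∀ S ∈ 𝒳, t ≤ #S) {B F : Finset α} :
    ∀ U ∈ tr 𝒳 B F, t - #B ≤ #U := fun U hU => by
  have h := hXt _ (mem_tr.1 hU).2
  have := card_union_le B U
  omega

omit [Fintype α] in
/-- **Plain supply of a cube**: `cH(ℓ, #F) · Σ_j #kindsIn_j(A,Y) ≤ C(#F, ℓ) · κ(D ∖ A, F)`, `F = A ∪ (T ∖ Y)`, `ℓ = t − #(D ∖ A)`.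
[this work] -/
theorem cube_plain_supply (h𝒳 : IsUpperSet (𝒳 : Set (Finset α))) (h𝒵 : IsUpperSet (𝒵 : Set (Finset α))) {t : ℕ}
    (hXt : ∀ S ∈ 𝒳, t ≤ #S) (hZt : ∀ S ∈ 𝒵, t ≤ #S) {m : α →₀ ℕ} {A Y : Finset α} (hA : A ⊆ dbl m) (hδt : #(dbl m) ≤ t) :
    (cH (t - #(dbl m \ A)) #(A ∪ (lev m 1 \ Y)) : ℤ) * ∑ j ∈ range (#(dbl m) + 1), (#(kindsIn 𝒳 𝒵 m t j A Y) : ℤ)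
      ≤ ((#(A ∪ (lev m 1 \ Y))).choose (t - #(dbl m \ A)) : ℤ) * kap 𝒳 𝒵 (dbl m \ A) (A ∪ (lev m 1 \ Y)) := by
  have hdisj : Disjoint (dbl m \ A) (A ∪ (lev m 1 \ Y)) :=
    disjoint_union_right.2 ⟨disjoint_sdiff_self_left, Disjoint.mono sdiff_subset sdiff_subset (disjoint_dbl_lev_one m)⟩
  have h := densityT_le_kap h𝒳 h𝒵 (t - #(dbl m \ A)) #(A ∪ (lev m 1 \ Y)) (dbl m \ A) (A ∪ (lev m 1 \ Y)) hdisj rfl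
    (le_card_of_mem_tr_cube hXt) (le_card_of_mem_tr_cube hZt)
  have hinc := sum_card_kindsIn_le_csetsT (𝒳 := 𝒳) (𝒵 := 𝒵) (Y := Y) hA hδt
  have hincZ : (∑ j ∈ range (#(dbl m) + 1), (#(kindsIn 𝒳 𝒵 m t j A Y) : ℤ))
      ≤ #(csetsT 𝒳 𝒵 (dbl m \ A) (A ∪ (lev m 1 \ Y)) (t - #(dbl m \ A))) := by exact_mod_cast hinc
  exact (mul_le_mul_of_nonneg_left hincZ (Nat.cast_nonneg _)).trans h

omit [Fintype α] in
/-- **Pinned supply of a cube** at `p ∈ A` (level `ℓ + 1 = t − #(D ∖ A)`, `#F = n + 1`, `2(ℓ+1) ≤ n + 1`):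
`cH(ℓ+1,n)·C(n,ℓ+1) · Σ_j #{kinds with p ∈ A'} + cH(ℓ,n)·C(n,ℓ) · Σ_j #{kinds with p ∉ A'} ≤ C(n,ℓ)·C(n,ℓ+1) · κ(D ∖ A, F)`.
[this work] -/
theorem cube_pinned_supply (h𝒳 : IsUpperSet (𝒳 : Set (Finset α))) (h𝒵 : IsUpperSet (𝒵 : Set (Finset α))) {t : ℕ}
    (hXt : ∀ S ∈ 𝒳, t ≤ #S) (hZt : ∀ S ∈ 𝒵, t ≤ #S) {m : α →₀ ℕ} {A Y : Finset α} (hA : A ⊆ dbl m) (hδt : #(dbl m) ≤ t)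
    {p : α} (hp : p ∈ A) {ℓ n : ℕ} (hℓ : ℓ + 1 + #(dbl m \ A) = t) (hn : #(A ∪ (lev m 1 \ Y)) = n + 1) (h2 : 2 * (ℓ + 1) ≤ n + 1) :
    ((cH (ℓ + 1) n * n.choose (ℓ + 1) : ℕ) : ℤ) * ∑ j ∈ range (#(dbl m) + 1), (#((kindsIn 𝒳 𝒵 m t j A Y).filter fun q => p ∈ q.1) : ℤ)
      + ((cH ℓ n * n.choose ℓ : ℕ) : ℤ) * ∑ j ∈ range (#(dbl m) + 1), (#((kindsIn 𝒳 𝒵 m t j A Y).filter fun q => p ∉ q.1) : ℤ)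
      ≤ ((n.choose ℓ * n.choose (ℓ + 1) : ℕ) : ℤ) * kap 𝒳 𝒵 (dbl m \ A) (A ∪ (lev m 1 \ Y)) := by
  have hdisj : Disjoint (dbl m \ A) (A ∪ (lev m 1 \ Y)) :=
    disjoint_union_right.2 ⟨disjoint_sdiff_self_left, Disjoint.mono sdiff_subset sdiff_subset (disjoint_dbl_lev_one m)⟩
  have hlev : t - #(dbl m \ A) = ℓ + 1 := by omega
  have hltX : ∀ U ∈ tr 𝒳 (dbl m \ A) (A ∪ (lev m 1 \ Y)), ℓ + 1 ≤ #U := fun U hU => by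
    have := le_card_of_mem_tr_cube hXt U hU; omega
  have hltZ : ∀ U ∈ tr 𝒵 (dbl m \ A) (A ∪ (lev m 1 \ Y)), ℓ + 1 ≤ #U := fun U hU => by
    have := le_card_of_mem_tr_cube hZt U hU; omega
  have h := pinnedT_le_kap h𝒳 h𝒵 ℓ n (dbl m \ A) (A ∪ (lev m 1 \ Y)) p hdisj hn (mem_union_left _ hp) h2 hltX hltZ
  have hin := sum_card_kindsIn_filter_mem_le (𝒳 := 𝒳) (𝒵 := 𝒵) (Y := Y) hA hδt hp
  have hout := sum_card_kindsIn_filter_not_mem_le (𝒳 := 𝒳) (𝒵 := 𝒵) (Y := Y) hA hδt hp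
  rw [hlev] at hin hout
  have hinZ : (∑ j ∈ range (#(dbl m) + 1), (#((kindsIn 𝒳 𝒵 m t j A Y).filter fun q => p ∈ q.1) : ℤ))
      ≤ #((csetsT 𝒳 𝒵 (dbl m \ A) (A ∪ (lev m 1 \ Y)) (ℓ + 1)).filter fun U => p ∈ U) := by exact_mod_cast hin
  have houtZ : (∑ j ∈ range (#(dbl m) + 1), (#((kindsIn 𝒳 𝒵 m t j A Y).filter fun q => p ∉ q.1) : ℤ))
      ≤ #((csetsT 𝒳 𝒵 (dbl m \ A) (A ∪ (lev m 1 \ Y)) (ℓ + 1)).filter fun U => p ∉ U) := by exact_mod_cast hout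
  have m1 := mul_le_mul_of_nonneg_left hinZ (Nat.cast_nonneg (cH (ℓ + 1) n * n.choose (ℓ + 1)))
  have m2 := mul_le_mul_of_nonneg_left houtZ (Nat.cast_nonneg (cH ℓ n * n.choose ℓ))
  linarith only [m1, m2, h]

end SupplyGeneralCube

end Summit.CriticalPhenomena.PercolationContinuityZ3.Theorems.SahiCTCForms
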